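import Summits.CriticalPhenomena.PercolationContinuityZ3.Theorems.PercNearOneGluingNoHeavyLowerTailThreePointHubEvents
import HarnessLib

/-!
# Four-terminal hub graphs: separation of a terminal set as a cylinder event (THEOREM H4, part 3a)

Support file for crux `stmt-CriticalPhenomena-4575` (`NoHeavyLowerTail`), seat `prim-facecert` gen 21 (`--supports stmt-CriticalPhenomena-4575`);
memo `run/shared/lean/prim/prim-l12/prim-facecert/FINDING-gen21-V4-HUB-GRAPHS.md` §1, §9.  Pattern of `…ThreePointHubEvents` (prim-l12-p1 gen 19) with
four terminals.  No sorries, standard axioms.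

Bond percolation on a finite vertex type `V`; four terminals `c u a b` (`terms4`), the other vertices are HUBS (`hubs4`).  For a set `X` of
terminals, `sepEv X` is the cylinder event "no terminal pair between `X` and the other terminals is open, and no hub has an open pair into `X`
together with an open pair into the other terminals"; off the null event `bad4` (some hub–hub pair open) it IS the event "no open path joins `X`
to a terminal outside `X`" (`sepEv_iff`, closure of `X ∪ {hubs with an open pair into X}` under open adjacency).  The hub parts are determined by
the pairwise disjoint pair sets `star4 h`, the terminal part by their complement, so probabilities of such events factor over the hubs
(`real_tInter_hInter`, from `prodBernoulli_real_inter_biInter_of_determinedBy`); `real_bad4`: the null event is null when `{c,u,a,b}` is a vertex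
cover of the positive-weight pairs.  [this work]
-/

namespace Summit.CriticalPhenomena.PercolationContinuityZ3.Theorems.SuperTerminalQuarticHubEvents

open MeasureTheory Set
open Literature.Probability.Percolation Literature.Probability.LatticeModels
open Summit.CriticalPhenomena.PercolationContinuityZ3.Theorems.ThreePointHubEvents (determinedBy_of_iff)

variable {V : Type*} [DecidableEq V]

/-! ## Terminals, hubs, star pairs, the null event -/

/-- The four terminals. [this work] -/
def terms4 (c u a b : V) : Finset V := {c, u, a, b}

/-- Membership in `terms4`. [this work] -/
@[simp] theorem mem_terms4 {c u a b v : V} : v ∈ terms4 c u a b ↔ v = c ∨ v = u ∨ v = a ∨ v = b := by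
  simp [terms4]

/-- The four pairs of the hub `h`. [this work] -/
def star4 (c u a b h : V) : Finset (Sym2 V) := {s(c, h), s(u, h), s(a, h), s(b, h)}

/-- Membership in `star4`. [this work] -/
theorem mem_star4 {c u a b h : V} {e : Sym2 V} : e ∈ star4 c u a b h ↔ ∃ x ∈ terms4 c u a b, e = s(x, h) := by
  simp only [star4, Finset.mem_insert, Finset.mem_singleton, mem_terms4]
  constructor
  · rintro (rfl | rfl | rfl | rfl)
    · exact ⟨c, Or.inl rfl, rfl⟩
    · exact ⟨u, Or.inr (Or.inl rfl), rfl⟩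
    · exact ⟨a, Or.inr (Or.inr (Or.inl rfl)), rfl⟩
    · exact ⟨b, Or.inr (Or.inr (Or.inr rfl)), rfl⟩
  · rintro ⟨x, hx, rfl⟩
    rcases hx with rfl | rfl | rfl | rfl <;> simp

/-! ## Separation events (hub and terminal parts) -/

/-- Hub part: the hub `h` has no open pair into `X` together with an open pair into a terminal outside `X`. [this work] -/
def hSep (X : Finset V) (c u a b h : V) : Set (BondConfig V) :=
  {ω | ¬ ((∃ x ∈ X, s(x, h) ∈ ω) ∧ ∃ y ∈ terms4 c u a b \ X, s(y, h) ∈ ω)}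

/-- Terminal part: no open terminal pair between `X` and the terminals outside `X`. [this work] -/
def tSep (X : Finset V) (c u a b : V) : Set (BondConfig V) := {ω | ∀ x ∈ X, ∀ y ∈ terms4 c u a b \ X, s(x, y) ∉ ω}

/-- `hSep X h` is determined by `star4 h` (for `X ⊆ terms4`). [this work] -/
theorem determinedBy_hSep {c u a b : V} {X : Finset V} (hX : X ⊆ terms4 c u a b) (h : V) :
    DeterminedBy (hSep X c u a b h) (↑(star4 c u a b h) : Set (Sym2 V)) := by
  refine determinedBy_of_iff fun ω ω' hF => ?_
  have hx : ∀ x ∈ terms4 c u a b, (s(x, h) ∈ ω ↔ s(x, h) ∈ ω') := fun x hx => hF _ (mem_star4.2 ⟨x, hx, rfl⟩)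
  simp only [hSep, mem_setOf_eq]
  refine not_congr (and_congr ?_ ?_)
  · exact exists_congr fun x => and_congr_right fun hxX => hx x (hX hxX)
  · exact exists_congr fun y => and_congr_right fun hy => hx y (Finset.mem_sdiff.1 hy).1

omit [DecidableEq V] in
/-- A star pair of the hub `h` is not a star pair of another hub `h'` (both outside `terms4`). [this work] -/
theorem starPair_ne' {c u a b x y h h' : V} (hx : x = c ∨ x = u ∨ x = a ∨ x = b) (hh : h ≠ h')
    (hh' : ¬ (h' = c ∨ h' = u ∨ h' = a ∨ h' = b)) : s(x, h) ≠ s(y, h') := by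
  intro e
  rcases Sym2.eq_iff.1 e with ⟨-, e2⟩ | ⟨e1, -⟩
  · exact hh e2
  · apply hh'
    rcases hx with rfl | rfl | rfl | rfl
    · exact Or.inl e1.symm
    · exact Or.inr (Or.inl e1.symm)
    · exact Or.inr (Or.inr (Or.inl e1.symm))
    · exact Or.inr (Or.inr (Or.inr e1.symm))

omit [DecidableEq V] in
/-- A terminal pair is not a star pair of a hub. [this work] -/
theorem termPair_ne_starPair' {c u a b x y z h : V} (hx : x = c ∨ x = u ∨ x = a ∨ x = b) (hy : y = c ∨ y = u ∨ y = a ∨ y = b)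
    (hh : ¬ (h = c ∨ h = u ∨ h = a ∨ h = b)) : s(x, y) ≠ s(z, h) := by
  intro e
  rcases Sym2.eq_iff.1 e with ⟨-, e2⟩ | ⟨e1, -⟩
  · apply hh
    rcases hy with rfl | rfl | rfl | rfl
    · exact Or.inl e2.symm
    · exact Or.inr (Or.inl e2.symm)
    · exact Or.inr (Or.inr (Or.inl e2.symm))
    · exact Or.inr (Or.inr (Or.inr e2.symm))
  · apply hh
    rcases hx with rfl | rfl | rfl | rfl
    · exact Or.inl e1.symm
    · exact Or.inr (Or.inl e1.symm)
    · exact Or.inr (Or.inr (Or.inl e1.symm))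
    · exact Or.inr (Or.inr (Or.inr e1.symm))

variable [Fintype V]

/-- The hubs: all vertices other than the four terminals. [this work] -/
def hubs4 (c u a b : V) : Finset V := Finset.univ.filter fun v => v ∉ terms4 c u a b

/-- Membership in `hubs4`. [this work] -/
@[simp] theorem mem_hubs4 {c u a b v : V} : v ∈ hubs4 c u a b ↔ ¬ (v = c ∨ v = u ∨ v = a ∨ v = b) := by
  simp [hubs4]

/-- The null event: some pair of distinct hubs is open. [this work] -/
def bad4 (c u a b : V) : Set (BondConfig V) := {ω | ∃ x y, x ∈ hubs4 c u a b ∧ y ∈ hubs4 c u a b ∧ x ≠ y ∧ s(x, y) ∈ ω}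

/-- The cylinder form of "`X` is separated from the other terminals". [this work] -/
def sepEv (X : Finset V) (c u a b : V) : Set (BondConfig V) := tSep X c u a b ∩ ⋂ h ∈ hubs4 c u a b, hSep X c u a b h

section walks
variable {c u a b : V} {X : Finset V} {ω : BondConfig V}

/-- The vertices reachable from `X` under separation: `X` and the hubs with an open pair into `X`. [this work] -/
def reachX (X : Finset V) (c u a b : V) (ω : BondConfig V) : Set V := {v | v ∈ X ∨ (v ∈ hubs4 c u a b ∧ ∃ x ∈ X, s(x, v) ∈ ω)}

/-- `reachX` is closed under open adjacency (on `sepEv X`, off the null event, for `X ⊆ terms4`). [this work] -/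
theorem reachX_closed (hω : ω ∈ sepEv X c u a b) (hN : ω ∉ bad4 c u a b) {p q : V}
    (hpq : (openGraph ω).Adj p q) (hp : p ∈ reachX X c u a b ω) : q ∈ reachX X c u a b ω := by
  rw [openGraph_adj] at hpq
  obtain ⟨he, hne⟩ := hpq
  obtain ⟨hT, hI⟩ := hω
  simp only [mem_iInter] at hI
  by_cases hqX : q ∈ X
  · exact Or.inl hqX
  by_cases hqT : q ∈ terms4 c u a b
  · -- `q` is a terminal outside `X`: impossible
    exfalso
    have hq' : q ∈ terms4 c u a b \ X := Finset.mem_sdiff.2 ⟨hqT, hqX⟩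
    rcases hp with hpX | ⟨hpH, x, hxX, hxp⟩
    · exact hT p hpX q hq' he
    · have hsep := hI p hpH
      simp only [hSep, mem_setOf_eq, not_and] at hsep
      exact hsep ⟨x, hxX, hxp⟩ ⟨q, hq', by rw [Sym2.eq_swap]; exact he⟩
  · -- `q` is a hub
    have hqH : q ∈ hubs4 c u a b := mem_hubs4.2 (fun h => hqT (mem_terms4.2 h))
    rcases hp with hpX | ⟨hpH, x, hxX, hxp⟩
    · exact Or.inr ⟨hqH, p, hpX, he⟩
    · exact (hN ⟨p, q, hpH, hqH, hne, he⟩).elim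

/-- Open walks from `reachX` stay in `reachX`. [this work] -/
theorem walk_stays (hω : ω ∈ sepEv X c u a b) (hN : ω ∉ bad4 c u a b) :
    ∀ {p q : V} (_ : (openGraph ω).Walk p q), p ∈ reachX X c u a b ω → q ∈ reachX X c u a b ω := by
  intro p q wk
  induction wk with
  | nil => exact id
  | cons h _ ih => exact fun hp => ih (reachX_closed hω hN h hp)

/-- **`sepEv X` is the separation of `X` from the other terminals** (`X ⊆ terms4`, off the null event). [this work] -/
theorem sepEv_iff (hX : X ⊆ terms4 c u a b) (hN : ω ∉ bad4 c u a b) :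
    ω ∈ sepEv X c u a b ↔ ∀ x ∈ X, ∀ y ∈ terms4 c u a b \ X, ¬ (openGraph ω).Reachable x y := by
  constructor
  · intro hω x hx y hy ⟨wk⟩
    have hyR : y ∈ reachX X c u a b ω := walk_stays hω hN wk (Or.inl hx)
    obtain ⟨hyT, hyX⟩ := Finset.mem_sdiff.1 hy
    rcases hyR with h | ⟨h, -⟩
    · exact hyX h
    · exact (mem_hubs4.1 h) ((mem_terms4.1 hyT))
  · intro h
    refine ⟨fun x hx y hy hxy => h x hx y hy ?_, ?_⟩
    · have hne : x ≠ y := by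
        rintro rfl; exact (Finset.mem_sdiff.1 hy).2 hx
      exact SimpleGraph.Adj.reachable ((openGraph_adj ω x y).2 ⟨hxy, hne⟩)
    · simp only [mem_iInter]
      intro k hk
      simp only [hSep, mem_setOf_eq, not_and]
      rintro ⟨x, hx, hxk⟩ ⟨y, hy, hyk⟩
      have hkT : ¬ (k = c ∨ k = u ∨ k = a ∨ k = b) := mem_hubs4.1 hk
      have hxk' : x ≠ k := by rintro rfl; exact hkT (mem_terms4.1 (hX hx))
      have hyk' : k ≠ y := by rintro rfl; exact hkT (mem_terms4.1 (Finset.mem_sdiff.1 hy).1)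
      have h1 : (openGraph ω).Reachable x k := SimpleGraph.Adj.reachable ((openGraph_adj ω x k).2 ⟨hxk, hxk'⟩)
      have h2 : (openGraph ω).Reachable k y :=
        SimpleGraph.Adj.reachable ((openGraph_adj ω k y).2 ⟨by rw [Sym2.eq_swap]; exact hyk, hyk'⟩)
      exact h x hx y hy (h1.trans h2)

end walks

/-! ## Determination by pairs, disjointness, product formula -/

section det
variable {c u a b : V}

/-- The star sets of distinct hubs are disjoint. [this work] -/
theorem pairwiseDisjoint_star4 (c u a b : V) :
    (↑(hubs4 c u a b) : Set V).PairwiseDisjoint fun h => star4 c u a b h := by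
  intro h hh h' hh' hne
  have hh'' := mem_hubs4.1 (Finset.mem_coe.1 hh')
  simp only [Function.onFun, Finset.disjoint_left]
  intro e he he'
  obtain ⟨x, hx, rfl⟩ := mem_star4.1 he
  obtain ⟨y, -, hy⟩ := mem_star4.1 he'
  exact starPair_ne' (mem_terms4.1 hx) hne hh'' hy

/-- An event depending only on terminal pairs is determined by the complement of all star sets. [this work] -/
theorem determinedBy_termEv {A : Set (BondConfig V)}
    (hA : ∀ ω ω' : BondConfig V, (∀ x ∈ terms4 c u a b, ∀ y ∈ terms4 c u a b, (s(x, y) ∈ ω ↔ s(x, y) ∈ ω')) → (ω ∈ A ↔ ω' ∈ A)) :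
    DeterminedBy A (⋃ h ∈ hubs4 c u a b, (↑(star4 c u a b h) : Set (Sym2 V)))ᶜ := by
  rw [determinedBy_iff]
  intro ω ω' hωω'
  refine hA ω ω' fun x hx y hy => ?_
  have hmem : s(x, y) ∈ (⋃ h ∈ hubs4 c u a b, (↑(star4 c u a b h) : Set (Sym2 V)))ᶜ := by
    intro hU
    obtain ⟨h, hh, he⟩ := mem_iUnion₂.1 hU
    obtain ⟨z, -, hz⟩ := mem_star4.1 (Finset.mem_coe.1 he)
    exact termPair_ne_starPair' (mem_terms4.1 hx) (mem_terms4.1 hy) (mem_hubs4.1 (Finset.mem_coe.1 hh)) hz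
  constructor
  · intro h1
    have : s(x, y) ∈ ω' ∩ (⋃ h ∈ hubs4 c u a b, (↑(star4 c u a b h) : Set (Sym2 V)))ᶜ := by rw [← hωω']; exact ⟨h1, hmem⟩
    exact this.1
  · intro h1
    have : s(x, y) ∈ ω ∩ (⋃ h ∈ hubs4 c u a b, (↑(star4 c u a b h) : Set (Sym2 V)))ᶜ := by rw [hωω']; exact ⟨h1, hmem⟩
    exact this.1

/-- `tSep X` is determined by the complement of all star sets (for `X ⊆ terms4`). [this work] -/
theorem determinedBy_tSep {X : Finset V} (hX : X ⊆ terms4 c u a b) :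
    DeterminedBy (tSep X c u a b) (⋃ h ∈ hubs4 c u a b, (↑(star4 c u a b h) : Set (Sym2 V)))ᶜ := by
  refine determinedBy_termEv fun ω ω' hF => ?_
  simp only [tSep, mem_setOf_eq]
  refine forall₂_congr fun x hx => forall₂_congr fun y hy => not_congr (hF x (hX hx) y (Finset.mem_sdiff.1 hy).1)

/-- **Product formula.**  An event of the form `T ∩ ⋂_{h ∈ hubs4} H h`, with `T` depending only on terminal pairs and each `H h` determined by
`star4 h`, has probability `P(T) · ∏_h P(H h)`. [this work] -/
theorem real_tInter_hInter (w : Sym2 V → unitInterval) {T : Set (BondConfig V)} {H : V → Set (BondConfig V)}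
    (hT : ∀ ω ω' : BondConfig V, (∀ x ∈ terms4 c u a b, ∀ y ∈ terms4 c u a b, (s(x, y) ∈ ω ↔ s(x, y) ∈ ω')) → (ω ∈ T ↔ ω' ∈ T))
    (hH : ∀ h ∈ hubs4 c u a b, DeterminedBy (H h) (↑(star4 c u a b h) : Set (Sym2 V))) :
    (prodBernoulli w).real (T ∩ ⋂ h ∈ hubs4 c u a b, H h) =
      (prodBernoulli w).real T * ∏ h ∈ hubs4 c u a b, (prodBernoulli w).real (H h) :=
  prodBernoulli_real_inter_biInter_of_determinedBy w (hubs4 c u a b) (fun h => star4 c u a b h) (pairwiseDisjoint_star4 c u a b)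
    hH (fun _ _ => MeasurableSet.of_discrete) (determinedBy_termEv hT) MeasurableSet.of_discrete

/-- The null event has probability `0` when every hub–hub pair has weight `0` (the terminals form a vertex cover). [this work] -/
theorem real_bad4 (w : Sym2 V → unitInterval)
    (hw : ∀ x ∈ hubs4 c u a b, ∀ y ∈ hubs4 c u a b, x ≠ y → (w s(x, y) : ℝ) = 0) :
    (prodBernoulli w).real (bad4 c u a b) = 0 := by
  set P : Finset (Sym2 V) := ((hubs4 c u a b ×ˢ hubs4 c u a b).filter fun xy => xy.1 ≠ xy.2).image fun xy => s(xy.1, xy.2) with hP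
  have hsub : bad4 c u a b ⊆ {ω : BondConfig V | ∃ e ∈ P, e ∈ ω} := by
    rintro ω ⟨x, y, hx, hy, hxy, he⟩
    refine ⟨s(x, y), ?_, he⟩
    rw [hP, Finset.mem_image]
    exact ⟨(x, y), Finset.mem_filter.2 ⟨Finset.mem_product.2 ⟨hx, hy⟩, hxy⟩, rfl⟩
  refine le_antisymm ?_ measureReal_nonneg
  refine (measureReal_mono hsub).trans ((prodBernoulli_real_exists_mem_le_sum w P).trans (le_of_eq (Finset.sum_eq_zero ?_)))
  intro e he
  rw [hP, Finset.mem_image] at he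
  obtain ⟨⟨x, y⟩, hxy, rfl⟩ := he
  rw [Finset.mem_filter, Finset.mem_product] at hxy
  exact hw x hxy.1.1 y hxy.1.2 hxy.2

omit [DecidableEq V] in
/-- Off a null event nothing changes: `P(A) = P(A ∩ Nᶜ)`. [this work] -/
theorem real_eq_real_inter_compl (w : Sym2 V → unitInterval) {N : Set (BondConfig V)} (hN : (prodBernoulli w).real N = 0)
    (A : Set (BondConfig V)) : (prodBernoulli w).real A = (prodBernoulli w).real (A ∩ Nᶜ) := by
  have h1 : (prodBernoulli w).real (A ∩ N) = 0 :=
    le_antisymm (le_trans (measureReal_mono inter_subset_right) (le_of_eq hN)) measureReal_nonneg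
  have h2 := measureReal_inter_add_sdiff (μ := prodBernoulli w) (s := A) (t := N) MeasurableSet.of_discrete
  rw [sdiff_eq] at h2
  linarith

omit [DecidableEq V] in
/-- Two events that agree off a null event have the same probability. [this work] -/
theorem real_congr_off_null (w : Sym2 V → unitInterval) {N A B : Set (BondConfig V)} (hN : (prodBernoulli w).real N = 0)
    (hAB : ∀ ω ∉ N, (ω ∈ A ↔ ω ∈ B)) : (prodBernoulli w).real A = (prodBernoulli w).real B := by
  rw [real_eq_real_inter_compl w hN A, real_eq_real_inter_compl w hN B]
  congr 1
  ext ω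
  simp only [mem_inter_iff, mem_compl_iff]
  constructor
  · rintro ⟨h1, h2⟩; exact ⟨(hAB ω h2).1 h1, h2⟩
  · rintro ⟨h1, h2⟩; exact ⟨(hAB ω h2).2 h1, h2⟩

end det

/-! ## Hub enumeration and creator events (definitions for `…SuperTerminalQuarticHubGraphs`, `…HubGraphsVC`; appended gen 21) -/

section enumdefs

/-- The `i`-th hub (`i < #hubs`), junk (`= c`) beyond. [this work] -/
noncomputable def hubAt (c u a b : V) (i : ℕ) : V :=
  if h : i < Fintype.card (hubs4 c u a b) then ((Fintype.equivFin (hubs4 c u a b)).symm ⟨i, h⟩ : V) else c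

/-- The index of a hub (junk `0` for non-hubs). [this work] -/
noncomputable def hubIdx (c u a b : V) (v : V) : ℕ :=
  if h : v ∈ hubs4 c u a b then (Fintype.equivFin (hubs4 c u a b) ⟨v, h⟩ : ℕ) else 0

/-- Hub part of the `j`-th creator event: hubs of index `< j` keep `b` isolated and do not join `u, a`; the hub of index `j` joins
`u, a` and not `b`; hubs of index `> j` keep `b` isolated. [this work] -/
def creatorH (c u a b : V) (j : ℕ) (h : V) : Set (BondConfig V) :=
  if hubIdx c u a b h < j then hSep {b} c u a b h ∩ {ω | ¬ (s(u, h) ∈ ω ∧ s(a, h) ∈ ω)}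
  else if hubIdx c u a b h = j then {ω | s(u, h) ∈ ω ∧ s(a, h) ∈ ω ∧ s(b, h) ∉ ω}
  else hSep {b} c u a b h

/-- The `j`-th creator event (the terminal pairs at `b` closed, every hub as in `creatorH j`). [this work] -/
def creatorEv (c u a b : V) (j : ℕ) : Set (BondConfig V) :=
  (tSep {b} c u a b ∩ tSep {b} c u a b ∩ tSep {b} c u a b) ∩ ⋂ h ∈ hubs4 c u a b, creatorH c u a b j h

/-- The creator event of the terminal piece: `b`'s terminal pairs closed, `u ↔ a` inside the terminal piece (`ua` open, or `cu` and `ca`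
open), and every hub a prefix hub (index `< #hubs`). [this work] -/
def termCreatorEv (c u a b : V) : Set (BondConfig V) :=
  ({ω : BondConfig V | s(c, b) ∉ ω ∧ s(u, b) ∉ ω ∧ s(a, b) ∉ ω} ∩ {ω | s(u, a) ∈ ω ∨ (s(c, u) ∈ ω ∧ s(c, a) ∈ ω)}) ∩
    ⋂ h ∈ hubs4 c u a b, creatorH c u a b (Fintype.card (hubs4 c u a b)) h

end enumdefs

end Summit.CriticalPhenomena.PercolationContinuityZ3.Theorems.SuperTerminalQuarticHubEvents
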